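import Summits.SmoothPoincare4.SmoothPoincare4.Theorems.SullivanDualWitnessChargeV15LeafFlocLaurent
import Summits.SmoothPoincare4.SmoothPoincare4.Theorems.SullivanDualWitnessChargeV15LeafFlocParam
import Summits.SmoothPoincare4.SmoothPoincare4.Theorems.SullivanDualWitnessChargeV15LeafFlocMember
import Summits.SmoothPoincare4.SmoothPoincare4.Theorems.SullivanDualWitnessChargeV15LeafFlocJoint
import Summits.SmoothPoincare4.SmoothPoincare4.Theorems.SullivanDualWitnessChargeV15LeafFlocCoeff
import Summits.SmoothPoincare4.SmoothPoincare4.Theorems.SullivanDualWitnessChargeLocalFamilyUniv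

/-!
# Stub `stub_leafFloc` (S6) of skeleton v15 — crux `WitnessCharge` (stmt-SmoothPoincare4-7824),
line `Sketch`, lead c8: the local family of pencil members read off from the leaves of the cap model

Registered stub `stub_leafFloc`. Given cap data `D : CapData S p J ε'`, a member `u₀` of intercept
`b₀` at an admissible scale, a jointly smooth family `(U a, V a)`, `‖a‖ < ε`, of embedded
`JX`-holomorphic two-chart spheres of `X` through the compactified member at `a = 0`, and the
intercept chart `(ε₁, r₁, δ, wz, α, β)` of stub `stub_interceptChart` (as hypotheses), we construct
`Floc : ℂ → ℂ → Σ ∖ p` with `Floc b₀ = u₀`, `Floc b` a pencil member of intercept `b` for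
`b ∈ ball b₀ δ`, jointly `C^∞` in `(b, ξ)` with injective differential, and
`range (ι ∘ Floc b) = (range (U (α b)) ∪ {V (α b) 0}) ∩ range ι` (the leaf minus its point on the
added line `E`). We take `δ' = δ`.

Construction. For the leaf `a = α b` let `w₀ = wz a` (the parameter of its point on `E`),
`g_a w = (capCoord (V a w)).1` (holomorphic on `‖w‖ < 1/2`, simple zero at `w₀`),
`c_a = g_a'(w₀) ≠ 0`, `d_a = −(g_a''(w₀)/2)/c_a²`, and the puncture parametrisation
`P_a ξ' = V a (w₀ + ξ'⁻¹)` (`ξ' ≠ 0`), `P_a 0 = U a 0` of the leaf minus `V a w₀ = capPt b`; then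
`Floc b ξ = ιinv (P_a (c_a (ξ − d_a)))`.

Assembly of the registered helpers of the stub:
* `helper_leafFloc_param` (`…V15LeafFlocParam`): `P_a` takes values in `range ι`, has the
  `U`-formula `P_a ξ' = U a (ξ'/(1 + w₀ ξ'))` near `0`, and `range P_a = leaf ∩ range ι`;
* `helper_leafFloc_coeff` (`…V15LeafFlocCoeff`): `a ↦ c_a`, `a ↦ g_a''(w₀)` are `C^∞` on
  `ball 0 ε₁`, hence so is `d_a`;
* `helper_leafFloc_joint` (`…V15LeafFlocJoint`): joint smoothness and injective differential of
  `(b, ξ) ↦ Floc b ξ` on `ball b₀ δ ×ˢ univ` (and of each slice `Floc b`);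
* `helper_leafFloc_member` (`…V15LeafFlocMember`, with the Laurent lemma
  `helper_leafFloc_laurent` of `…V15LeafFlocLaurent`): each `Floc b` is a pencil member of
  intercept `β (α b) = b` with the stated range;
* `Floc b₀ = u₀`: `α b₀ = 0`, `(U 0, V 0) = (sphereU u₀ lam, sphereV u₀ b₀ lam)`, so
  `range (ι ∘ Floc b₀) = ι (range u₀)`, and two members with the same range are equal
  (`IsPencilPlane.eq_of_range_eq`).
-/

noncomputable section

set_option linter.dupNamespace false

open scoped Manifold ContDiff Topology
open Set Filter Literature.Geometry.Symplectic Literature.Topology.FourManifolds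

namespace Summit.SmoothPoincare4.SmoothPoincare4.Theorems.WitnessCharge.PencilIncompleteness

/-- **Stub S6 `stub_leafFloc` — the local family `Floc` of pencil members from the leaves of the
cap model** (registered statement of skeleton v15, verbatim). See the module docstring for the
construction and the assembly of the registered helpers `helper_leafFloc_param`,
`helper_leafFloc_coeff`, `helper_leafFloc_joint`, `helper_leafFloc_member`. -/
theorem stub_leafFloc :
    ∀ (S : HomotopySphere 4) (p : S.carrier)
      (J : ∀ x : punctured p, TangentSpace (𝓡 4) x →L[ℝ] TangentSpace (𝓡 4) x) (ε' : ℝ)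
      (hε' : 0 < ε')
      (hball : Metric.closedBall (extChartAt (𝓡 4) p p) ε' ⊆ (extChartAt (𝓡 4) p).target),
      (∀ (x : punctured p) (v : TangentSpace (𝓡 4) x), J x (J x v) = -v) →
      (∀ x₀ : punctured p, ContMDiffAt (𝓡 4) 𝓘(ℝ, EuclideanSpace ℝ (Fin 4) →L[ℝ] EuclideanSpace ℝ (Fin 4)) ∞
        (inTangentCoordinates (𝓡 4) (𝓡 4) (id : punctured p → punctured p) id (fun x => J x) x₀) x₀) →
      (∀ x : punctured p, InPuncturedChartBall p ε' x →
        ∀ (v : TangentSpace (𝓡 4) x) (b : EuclideanSpace ℝ (Fin 4)),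
          inner ℝ (fderiv ℝ inversion (extChartAt (𝓡 4) p x.1 - extChartAt (𝓡 4) p p)
            (mfderiv (𝓡 4) 𝓘(ℝ, EuclideanSpace ℝ (Fin 4))
              (fun z : punctured p => extChartAt (𝓡 4) p z.1) x (J x v))) b
          = stdSymplecticForm (fderiv ℝ inversion (extChartAt (𝓡 4) p x.1 - extChartAt (𝓡 4) p p)
            (mfderiv (𝓡 4) 𝓘(ℝ, EuclideanSpace ℝ (Fin 4))
              (fun z : punctured p => extChartAt (𝓡 4) p z.1) x v)) b) →
      ∀ (D : CapData S p J ε') (u₀ : ℂ → punctured p) (b₀ : ℂ) (lam : ℝ),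
      IsPencilMember J u₀ b₀ → D.AdmissibleScale u₀ lam →
      ∀ (ε : ℝ) (U V : ℂ → ℂ → D.X), 0 < ε →
      (∀ z, U 0 z = D.sphereU u₀ lam z) → (∀ w, V 0 w = D.sphereV u₀ b₀ lam w) →
      (∀ a : ℂ, ‖a‖ < ε →
        ContMDiff 𝓘(ℝ, ℂ) (𝓡 4) ∞ (U a) ∧ ContMDiff 𝓘(ℝ, ℂ) (𝓡 4) ∞ (V a) ∧
        (∀ z : ℂ, z ≠ 0 → V a z = U a z⁻¹) ∧
        IsJHolomorphic (𝓡 4) (fun y => D.JX y) (U a) ∧ IsJHolomorphic (𝓡 4) (fun y => D.JX y) (V a) ∧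
        Function.Injective (U a) ∧ (∀ z, Function.Injective (mfderiv 𝓘(ℝ, ℂ) (𝓡 4) (U a) z)) ∧
        Function.Injective (mfderiv 𝓘(ℝ, ℂ) (𝓡 4) (V a) 0) ∧ V a 0 ∉ range (U a)) →
      ContMDiffOn 𝓘(ℝ, ℂ × ℂ) (𝓡 4) ∞ (fun q : ℂ × ℂ => U q.1 q.2) (Metric.ball 0 ε ×ˢ univ) →
      ContMDiffOn 𝓘(ℝ, ℂ × ℂ) (𝓡 4) ∞ (fun q : ℂ × ℂ => V q.1 q.2) (Metric.ball 0 ε ×ˢ univ) →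
      (∀ q ∈ Metric.ball (0 : ℂ) ε ×ˢ (univ : Set ℂ),
        Function.Injective (mfderiv 𝓘(ℝ, ℂ × ℂ) (𝓡 4) (fun q : ℂ × ℂ => U q.1 q.2) q) ∧
        Function.Injective (mfderiv 𝓘(ℝ, ℂ × ℂ) (𝓡 4) (fun q : ℂ × ℂ => V q.1 q.2) q)) →
      ∀ (ε₁ r₁ δ : ℝ) (wz α β : ℂ → ℂ), 0 < ε₁ →
        ε₁ ≤ ε →
        0 < r₁ →
        r₁ ≤ 4⁻¹ →
        0 < δ →
        ContDiffOn ℝ ∞ wz (Metric.ball 0 ε₁) →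
        wz 0 = 0 →
        (∀ a ∈ Metric.ball (0 : ℂ) ε₁, ‖wz a‖ < r₁) →
        (∀ a ∈ Metric.ball (0 : ℂ) ε₁, ∀ w : ℂ, ‖w‖ < 2⁻¹ →
          V a w ∈ D.capInv '' {q : ℂ × ℂ | ‖q.1‖ < D.ρ}) →
        (∀ a ∈ Metric.ball (0 : ℂ) ε₁, ∀ w : ℂ, ‖w‖ ≤ 2⁻¹ → (V a w ∈ range D.capPt ↔ w = wz a)) →
        (∀ a ∈ Metric.ball (0 : ℂ) ε₁, ∀ z : ℂ, ‖z‖ ≤ 2 → U a z ∈ range D.ι) →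
        (∀ a ∈ Metric.ball (0 : ℂ) ε₁, DifferentiableOn ℂ (fun w => D.capCoord (V a w)) (Metric.ball 0 2⁻¹)) →
        (∀ a ∈ Metric.ball (0 : ℂ) ε₁, deriv (fun w => (D.capCoord (V a w)).1) (wz a) ≠ 0) →
        (∀ a ∈ Metric.ball (0 : ℂ) ε₁, V a (wz a) = D.capPt (β a)) →
        (∀ a ∈ Metric.ball (0 : ℂ) ε₁, β a = (D.capCoord (V a (wz a))).2) →
        ContDiffOn ℝ ∞ β (Metric.ball 0 ε₁) →
        β 0 = b₀ →
        ContDiffOn ℝ ∞ α (Metric.ball b₀ δ) →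
        α b₀ = 0 →
        (∀ b ∈ Metric.ball b₀ δ, α b ∈ Metric.ball (0 : ℂ) ε₁ ∧ β (α b) = b) →
        (∀ a ∈ Metric.ball (0 : ℂ) ε₁, β a ∈ Metric.ball b₀ δ → α (β a) = a) →
        (∀ b ∈ Metric.ball b₀ δ, Function.Bijective (fderiv ℝ α b)) →
      ∃ (δ' : ℝ) (Floc : ℂ → ℂ → punctured p), 0 < δ' ∧ δ' ≤ δ ∧ Floc b₀ = u₀ ∧
        (∀ b ∈ Metric.ball b₀ δ', IsPencilMember J (Floc b) b) ∧
        ContMDiffOn 𝓘(ℝ, ℂ × ℂ) (𝓡 4) ∞ (fun q : ℂ × ℂ => Floc q.1 q.2)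
          ((Metric.ball b₀ δ') ×ˢ (univ : Set ℂ)) ∧
        (∀ q : ℂ × ℂ, q.1 ∈ Metric.ball b₀ δ' →
          Function.Injective (mfderiv 𝓘(ℝ, ℂ × ℂ) (𝓡 4) (fun q : ℂ × ℂ => Floc q.1 q.2) q)) ∧
        (∀ b ∈ Metric.ball b₀ δ', range (D.ι ∘ Floc b) = (range (U (α b)) ∪ {V (α b) 0}) ∩ range D.ι) := by
  intro S p J ε' _ _ _ _ _ D u₀ b₀ lam hu₀ hlam ε U V _ hU0 hV0 hUV hEvU hEvV hinj ε₁ r₁ δ wz α β _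
    hε₁ε _ hr₁4 hδ hwz _ hwzr hVcap hVE hUι hVdiff hderiv hVwz _ _ _ hαs hα0 hαβ _ hDα
  -- the renormalisation constants of the leaf `a`
  obtain ⟨cf, hcf⟩ : ∃ cf : ℂ → ℂ, ∀ a, cf a = deriv (fun w => (D.capCoord (V a w)).1) (wz a) :=
    ⟨_, fun _ => rfl⟩
  obtain ⟨ef, hef⟩ : ∃ ef : ℂ → ℂ,
      ∀ a, ef a = deriv (deriv (fun w => (D.capCoord (V a w)).1)) (wz a) := ⟨_, fun _ => rfl⟩
  obtain ⟨df, hdf⟩ : ∃ df : ℂ → ℂ, ∀ a, df a = -(ef a / 2) / (cf a) ^ 2 := ⟨_, fun _ => rfl⟩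
  -- the puncture parametrisations of the leaves and the family
  obtain ⟨P, hP⟩ : ∃ P : ℂ → ℂ → D.X,
      ∀ a ξ', P a ξ' = if ξ' = 0 then U a 0 else V a (wz a + ξ'⁻¹) := ⟨_, fun _ _ => rfl⟩
  have hPne : ∀ a ξ' : ℂ, ξ' ≠ 0 → P a ξ' = V a (wz a + ξ'⁻¹) := fun a ξ' h => by
    rw [hP, if_neg h]
  have hP0 : ∀ a : ℂ, P a 0 = U a 0 := fun a => by rw [hP, if_pos rfl]
  obtain ⟨Floc, hFloc⟩ : ∃ Floc : ℂ → ℂ → punctured p,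
      ∀ b ξ, Floc b ξ = D.ιinv (P (α b) (cf (α b) * (ξ - df (α b)))) := ⟨_, fun _ _ => rfl⟩
  -- elementary bookkeeping
  have ha : ∀ b ∈ Metric.ball b₀ δ, α b ∈ Metric.ball (0 : ℂ) ε₁ := fun b hb => (hαβ b hb).1
  have ha' : ∀ b ∈ Metric.ball b₀ δ, ‖α b‖ < ε := fun b hb => by
    have h := ha b hb
    rw [Metric.mem_ball, dist_zero_right] at h
    exact h.trans_le hε₁ε
  have hwz4 : ∀ a ∈ Metric.ball (0 : ℂ) ε₁, ‖wz a‖ < 4⁻¹ := fun a h => (hwzr a h).trans_le hr₁4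
  have hcf0 : ∀ a ∈ Metric.ball (0 : ℂ) ε₁, cf a ≠ 0 := fun a h => by rw [hcf]; exact hderiv a h
  -- the set-theoretic properties of the puncture parametrisations
  have hparam : ∀ b ∈ Metric.ball b₀ δ,
      (∀ ξ' : ℂ, 1 + wz (α b) * ξ' ≠ 0 → P (α b) ξ' = U (α b) (ξ' / (1 + wz (α b) * ξ'))) ∧
      (∀ ξ' : ℂ, P (α b) ξ' ∈ range D.ι) ∧
      range (P (α b)) = (range (U (α b)) ∪ {V (α b) 0}) ∩ range D.ι ∧
      Function.Injective (P (α b)) ∧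
      (∀ w : ℂ, ‖w‖ < 2⁻¹ → w ≠ wz (α b) → (D.capCoord (V (α b) w)).1 ≠ 0 ∧
        ∃ x : punctured p, V (α b) w = D.ι x ∧ InPuncturedChartBall p ε' x ∧
          Ycoord p x = (((D.capCoord (V (α b) w)).1)⁻¹, (D.capCoord (V (α b) w)).2)) := by
    intro b hb
    obtain ⟨-, -, hUVa, -, -, hUinj, -, -, hV0a⟩ := hUV (α b) (ha' b hb)
    exact helper_leafFloc_param S p J ε' D (U (α b)) (V (α b)) (wz (α b)) (P (α b)) hUVa hUinj
      hV0a (hVcap _ (ha b hb)) (hVE _ (ha b hb)) (hUι _ (ha b hb)) (hwz4 _ (ha b hb))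
      (hPne (α b)) (hP0 (α b))
  have hιF : ∀ b ∈ Metric.ball b₀ δ, ∀ ξ : ℂ,
      D.ι (Floc b ξ) = P (α b) (cf (α b) * (ξ - df (α b))) := by
    intro b hb ξ
    obtain ⟨x, hx⟩ := (hparam b hb).2.1 (cf (α b) * (ξ - df (α b)))
    rw [hFloc, ← hx, D.ιinv_ι]
  -- smoothness of the constants in the leaf parameter
  obtain ⟨hc1, hc2⟩ := helper_leafFloc_coeff S p J ε' D V ε ε₁ wz hEvV hε₁ε hwz hwz4 hVcap hVdiff
  have hcfs : ContDiffOn ℝ ∞ cf (Metric.ball 0 ε₁) := hc1.congr fun a _ => hcf a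
  have hefs : ContDiffOn ℝ ∞ ef (Metric.ball 0 ε₁) := hc2.congr fun a _ => hef a
  have hdfs : ContDiffOn ℝ ∞ df (Metric.ball 0 ε₁) := by
    have h : ContDiffOn ℝ ∞ (fun a => -(ef a / 2) * ((cf a) ^ 2)⁻¹) (Metric.ball 0 ε₁) :=
      (hefs.div_const 2).neg.mul ((hcfs.pow 2).inv fun a h => pow_ne_zero 2 (hcf0 a h))
    exact h.congr fun a _ => by rw [hdf, div_eq_mul_inv]
  -- joint smoothness and injective differential
  obtain ⟨hΦs, hΦinj, hsl, hsl'⟩ := helper_leafFloc_joint S p J ε' D U V ε ε₁ δ b₀ wz α cf df Floc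
    hEvU hEvV hinj hε₁ε hwz hcfs hdfs hcf0 hαs ha hDα
    (fun b hb ξ hne => by rw [hιF b hb ξ, (hparam b hb).1 _ hne])
    (fun b hb ξ hne => by rw [hιF b hb ξ, hPne _ _ hne])
  -- each `Floc b` is a member of intercept `b` with the stated range
  have hmem : ∀ b ∈ Metric.ball b₀ δ, IsPencilMember J (Floc b) b ∧
      range (D.ι ∘ Floc b) = (range (U (α b)) ∪ {V (α b) 0}) ∩ range D.ι := by
    intro b hb
    obtain ⟨hUsm, hVsm, -, hUj, hVj, -, -, -, -⟩ := hUV (α b) (ha' b hb)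
    obtain ⟨hPU, hPι, hrange, hPinj, hflat⟩ := hparam b hb
    have hVw₀ : V (α b) (wz (α b)) = D.capPt b := by rw [hVwz _ (ha b hb), (hαβ b hb).2]
    -- the Laurent asymptotics of the `t`-coordinate of the leaf at its simple zero `wz (α b)`
    have hw₀b : wz (α b) ∈ Metric.ball (0 : ℂ) 2⁻¹ := by
      rw [Metric.mem_ball, dist_zero_right]
      exact (hwz4 _ (ha b hb)).trans (by norm_num)
    have hg0 : (D.capCoord (V (α b) (wz (α b)))).1 = 0 := by rw [hVw₀, D.leafFloc_capCoord_capPt]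
    have hL := helper_leafFloc_laurent (fun w => (D.capCoord (V (α b) w)).1) (Metric.ball 0 2⁻¹)
      (wz (α b)) Metric.isOpen_ball hw₀b (hVdiff _ (ha b hb)).fst hg0 (hderiv _ (ha b hb))
    rw [← hcf, ← hef, ← hdf] at hL
    exact helper_leafFloc_member S p J ε' D (U (α b)) (V (α b)) (wz (α b)) (cf (α b)) (df (α b)) b
      (P (α b)) (Floc b) hUsm hVsm hUj hVj (hVdiff _ (ha b hb)) (hcf0 _ (ha b hb)) hL hVw₀
      (hwz4 _ (ha b hb)) (hPne (α b)) hPU hPι hrange hPinj hflat (hιF b hb) (hsl b hb) (hsl' b hb)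
  -- `Floc b₀ = u₀`
  have hFloc0 : Floc b₀ = u₀ := by
    have hb₀ : b₀ ∈ Metric.ball b₀ δ := Metric.mem_ball_self hδ
    obtain ⟨hmem0, hrange0⟩ := hmem b₀ hb₀
    rw [hα0] at hrange0
    have hlam0 : (lam : ℂ) ≠ 0 := by
      have h4 : (4 : ℝ) ≤ lam := hlam.1
      exact Complex.ofReal_ne_zero.2 (by linarith)
    have hU0r : range (U 0) = D.ι '' range u₀ := by
      ext y
      constructor
      · rintro ⟨z, rfl⟩
        rw [hU0, CapData.sphereU_apply]
        exact ⟨_, ⟨_, rfl⟩, rfl⟩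
      · rintro ⟨_, ⟨ξ, rfl⟩, rfl⟩
        refine ⟨ξ / lam, ?_⟩
        rw [hU0, CapData.sphereU_apply, mul_div_cancel₀ _ hlam0]
    have hV00 : V 0 0 = D.capPt b₀ := by rw [hV0, CapData.sphereV_zero]
    have hR : (range (U 0) ∪ {V 0 0}) ∩ range D.ι = D.ι '' range u₀ := by
      rw [hV00, hU0r]
      apply Subset.antisymm
      · rintro y ⟨hy | hy, hyι⟩
        · exact hy
        · exfalso
          rw [mem_singleton_iff] at hy
          obtain ⟨x, rfl⟩ := hyι
          exact D.ι_ne_capPt x b₀ hy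
      · intro y hy
        refine ⟨Or.inl hy, ?_⟩
        obtain ⟨x, -, rfl⟩ := hy
        exact ⟨x, rfl⟩
    rw [hR, range_comp] at hrange0
    have hreq : range (Floc b₀) = range u₀ := (image_eq_image D.leafFloc_ι_injective).1 hrange0
    exact (isPencilMember_iff_isPencilPlane.1 hmem0).eq_of_range_eq
      (isPencilMember_iff_isPencilPlane.1 hu₀) hreq
  exact ⟨δ, Floc, hδ, le_rfl, hFloc0, fun b hb => (hmem b hb).1, hΦs, hΦinj,
    fun b hb => (hmem b hb).2⟩

end Summit.SmoothPoincare4.SmoothPoincare4.Theorems.WitnessCharge.PencilIncompleteness
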